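import Summits.ValiantsHypothesis.ValiantsHypothesis.Theorems.BarrierLeverDefinableEquationsTorusWeights
import Literature.Computability.AlgebraicComplexity.DeterminantalComplexityProofs

/-!
# Cruxes `BarrierLever.DefinableEquations` (stmt-ValiantsHypothesis-8745) / `SingleSizeEquations` (8749) /
# `DefinableDcEquations` (8746) — BOREL STABILITY: affine substitutions, in particular the
# unipotent translates `x_j ↦ x_j + Σ_{i<j} s_ij x_i`, keep the crux's classes

First file of the "U-half" of the normal-form programme (design memo `HWV-NORMAL-FORM-PLAN.md`,
evidence #9 on stmt-ValiantsHypothesis-8749): the torus part (`…TorusWeights/Isobaric/WeightVector/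
DominantWeight.lean`) shows the witness may be taken a weight vector; to reach a HIGHEST weight vector
one needs that the simple classes are stable under the unipotent radical as well.  This file records
the geometric facts, in the tree's measures:

* `complexity_aeval_affine_le` — substituting affine forms `g_k` costs `L(f) + Σ_k L(g_k)`
  (`complexity_aeval_le`) and does not raise the degree (`totalDegree_aeval_affine_le`);
* `hasDetRepr_aeval_affine`, `determinantalComplexity_aeval_affine_le` — an affine substitution inside
  an affine determinantal representation is again one, of the same size: `dc(f ∘ g) ≤ dc f`
  (no exception at `dc f = 0`);
* `elemUnipotent_mem_smallCircuits` — one elementary unipotent `x_j ↦ x_j + σ x_i` maps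
  `SmallCircuits ℂ n b` into `SmallCircuits ℂ n (b+1)` (`n ≥ 3`); `unipotent_mem_smallCircuits` — the
  full upper unitriangular substitution `x_j ↦ x_j + Σ_{i<j} s_ij x_i` maps `SmallCircuits ℂ n b` into
  `SmallCircuits ℂ n (b+2)` (`b ≥ 1`, `n ≥ 3`); `unipotent_mem_dcSlice` — and keeps every dc-slice
  `{deg ≤ n, dc ≤ M}` on the nose;
* `eval_eq_zero_of_unipotent` — hence an equation at rung `b+2` vanishes at the coefficient vector of
  every unipotent translate of every member of rung `b`.

Elementary; no definitions, no named facts.  HONEST FRAMING: infrastructure; nothing on the open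
content of the cruxes.  References: [Burgisser2000] Rem. 2.7; [MignonRessayre2004] §1.
-/

-- layout Summits/ValiantsHypothesis/ValiantsHypothesis forces the duplicated namespace component
set_option linter.dupNamespace false

noncomputable section

open MvPolynomial

namespace Summit.ValiantsHypothesis.ValiantsHypothesis.Theorems.BarrierLever.IsobaricEquations

open Literature.Computability.AlgebraicComplexity Literature.Barriers.ValiantsHypothesis

variable {n : ℕ}

/-! ## §1 Affine substitutions -/

/-- Affine substitutions do not raise the degree. [cite: Burgisser2000, §2.1] -/
theorem totalDegree_aeval_affine_le (g : Fin n → MvPolynomial (Fin n) ℂ)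
    (hg : ∀ k, (g k).totalDegree ≤ 1) (f : MvPolynomial (Fin n) ℂ) :
    (aeval g f).totalDegree ≤ f.totalDegree :=
  HasDetRepr.totalDegree_aeval_le_of_le_one g hg f

/-- Substitution cost: `L(f ∘ g) ≤ L(f) + Σ_k L(g_k)`. [cite: Burgisser2000, Rem. 2.7] -/
theorem complexity_aeval_affine_le (g : Fin n → MvPolynomial (Fin n) ℂ) (f : MvPolynomial (Fin n) ℂ) :
    complexity (aeval g f) ≤ complexity f + ∑ k, complexity (g k) :=
  complexity_aeval_le f g

/-- **An affine substitution inside an affine determinantal representation** is again one, of the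
same size. [cite: MignonRessayre2004, §1] -/
theorem hasDetRepr_aeval_affine {f : MvPolynomial (Fin n) ℂ} {m : ℕ} (h : HasDetRepr f m)
    (g : Fin n → MvPolynomial (Fin n) ℂ) (hg : ∀ k, (g k).totalDegree ≤ 1) :
    HasDetRepr (aeval g f) m := by
  obtain ⟨A, hA1, hAdet⟩ := h
  refine ⟨(aeval g).mapMatrix A, fun i j => ?_, ?_⟩
  · rw [AlgHom.mapMatrix_apply, Matrix.map_apply]
    exact (HasDetRepr.totalDegree_aeval_le_of_le_one g hg _).trans (hA1 i j)
  · rw [← AlgHom.map_det, hAdet]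

/-- **`dc(f ∘ g) ≤ dc f` for affine `g`.** [cite: MignonRessayre2004, §1] -/
theorem determinantalComplexity_aeval_affine_le (f : MvPolynomial (Fin n) ℂ)
    (g : Fin n → MvPolynomial (Fin n) ℂ) (hg : ∀ k, (g k).totalDegree ≤ 1) :
    determinantalComplexity (aeval g f) ≤ determinantalComplexity f :=
  determinantalComplexity_le_of_hasDetRepr
    (hasDetRepr_aeval_affine (hasDetRepr_determinantalComplexity_holds (k := ℂ) (σ := Fin n) f) g hg)

/-! ## §2 Unipotent translates -/

/-- The elementary unipotent substitution `x_j ↦ x_j + σ x_i` (other variables fixed) has affine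
components. [folklore] -/
theorem elemUnipotent_affine (i j : Fin n) (σ : ℂ) (k : Fin n) :
    ((if k = j then X j + C σ * X i else X k : MvPolynomial (Fin n) ℂ)).totalDegree ≤ 1 := by
  split_ifs
  · refine (totalDegree_add _ _).trans (max_le ?_ ?_)
    · rw [totalDegree_X]
    · refine (totalDegree_mul _ _).trans ?_
      rw [totalDegree_C, totalDegree_X, zero_add]
  · rw [totalDegree_X]

/-- Size of the components of the elementary unipotent substitution: `≤ 2` in total. [folklore] -/
theorem complexity_elemUnipotent_sum_le (i j : Fin n) (σ : ℂ) :
    ∑ k : Fin n, complexity ((if k = j then X j + C σ * X i else X k : MvPolynomial (Fin n) ℂ)) ≤ 2 := by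
  classical
  have hmul : complexity (C σ * X i : MvPolynomial (Fin n) ℂ) ≤ 1 := by
    have h := complexity_mul_le_holds (C σ : MvPolynomial (Fin n) ℂ) (X i)
    rw [complexity_C_holds, complexity_X_holds] at h
    exact h
  have hj : complexity (X j + C σ * X i : MvPolynomial (Fin n) ℂ) ≤ 2 := by
    have h := complexity_add_le_holds (X j : MvPolynomial (Fin n) ℂ) (C σ * X i)
    rw [complexity_X_holds] at h
    omega
  rw [Finset.sum_eq_single j]
  · rw [if_pos rfl]; exact hj
  · intro k _ hk
    rw [if_neg hk]; exact complexity_X_holds _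
  · intro h; exact absurd (Finset.mem_univ j) h

/-- **One elementary unipotent keeps the class, one rung up**: for `n ≥ 3` and
`f ∈ SmallCircuits ℂ n b`, `f(…, x_j + σ x_i, …) ∈ SmallCircuits ℂ n (b+1)` (two extra gates).
[cite: Burgisser2000, Rem. 2.7] -/
theorem elemUnipotent_mem_smallCircuits (hn : 3 ≤ n) (i j : Fin n) (σ : ℂ) {b : ℕ}
    {f : MvPolynomial (Fin n) ℂ} (hf : f ∈ SmallCircuits ℂ n b) :
    aeval (fun k => (if k = j then X j + C σ * X i else X k : MvPolynomial (Fin n) ℂ)) f ∈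
      SmallCircuits ℂ n (b + 1) := by
  obtain ⟨hdeg, hL⟩ := hf
  refine ⟨(totalDegree_aeval_affine_le _ (elemUnipotent_affine i j σ) f).trans hdeg, ?_⟩
  refine (complexity_aeval_affine_le _ f).trans ?_
  calc complexity f + _ ≤ n ^ b + 2 := Nat.add_le_add hL (complexity_elemUnipotent_sum_le i j σ)
    _ ≤ n ^ (b + 1) := by
        have h1 : 1 ≤ n ^ b := Nat.one_le_pow _ _ (by omega)
        rw [pow_succ]; nlinarith

/-- The upper unitriangular substitution `x_j ↦ x_j + Σ_{i<j} s_ij x_i` has affine components of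
size `≤ 3j` each. [folklore] -/
theorem unipotent_affine (s : Fin n → Fin n → ℂ) (j : Fin n) :
    (X j + ∑ i ∈ Finset.univ.filter (fun i : Fin n => i < j), C (s i j) * X i :
      MvPolynomial (Fin n) ℂ).totalDegree ≤ 1 := by
  refine (totalDegree_add _ _).trans (max_le ?_ ?_)
  · rw [totalDegree_X]
  · refine totalDegree_finsetSum_le fun i _ => (totalDegree_mul _ _).trans ?_
    rw [totalDegree_C, totalDegree_X, zero_add]

/-- Size of one row of the unipotent substitution: `≤ 2n + 1`. [cite: Burgisser2000, §2.1] -/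
theorem complexity_unipotent_row_le (s : Fin n → Fin n → ℂ) (j : Fin n) :
    complexity (X j + ∑ i ∈ Finset.univ.filter (fun i : Fin n => i < j), C (s i j) * X i :
      MvPolynomial (Fin n) ℂ) ≤ 2 * n + 1 := by
  classical
  have hsum : complexity (∑ i ∈ Finset.univ.filter (fun i : Fin n => i < j), C (s i j) * X i :
      MvPolynomial (Fin n) ℂ) ≤ 2 * n := by
    refine (complexity_finset_sum_le _ _).trans ?_
    have hcard : (Finset.univ.filter (fun i : Fin n => i < j)).card ≤ n :=
      (Finset.card_filter_le _ _).trans (by rw [Finset.card_univ, Fintype.card_fin])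
    calc ∑ i ∈ Finset.univ.filter (fun i : Fin n => i < j),
          complexity (C (s i j) * X i : MvPolynomial (Fin n) ℂ) +
          (Finset.univ.filter (fun i : Fin n => i < j)).card
        ≤ ∑ _i ∈ Finset.univ.filter (fun i : Fin n => i < j), 1 + n := by
          refine Nat.add_le_add (Finset.sum_le_sum fun i _ => ?_) hcard
          have h := complexity_mul_le_holds (C (s i j) : MvPolynomial (Fin n) ℂ) (X i)
          rw [complexity_C_holds, complexity_X_holds] at h
          exact h
      _ ≤ n + n := by rw [Finset.sum_const, smul_eq_mul, mul_one]; exact Nat.add_le_add_right hcard _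
      _ = 2 * n := by ring
  calc complexity (X j + ∑ i ∈ Finset.univ.filter (fun i : Fin n => i < j), C (s i j) * X i :
        MvPolynomial (Fin n) ℂ)
      ≤ complexity (X j : MvPolynomial (Fin n) ℂ) +
          complexity (∑ i ∈ Finset.univ.filter (fun i : Fin n => i < j), C (s i j) * X i :
            MvPolynomial (Fin n) ℂ) + 1 := complexity_add_le_holds _ _
    _ ≤ 0 + 2 * n + 1 := by rw [complexity_X_holds]; omega
    _ = 2 * n + 1 := by ring

/-- **The unipotent radical keeps the class, two rungs up**: for `b ≥ 1`, `n ≥ 3` and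
`f ∈ SmallCircuits ℂ n b`, `f(u_s x) ∈ SmallCircuits ℂ n (b+2)` where
`(u_s x)_j = x_j + Σ_{i<j} s_ij x_i`. [cite: Burgisser2000, Rem. 2.7] -/
theorem unipotent_mem_smallCircuits (hn : 3 ≤ n) {b : ℕ} (hb : 1 ≤ b) (s : Fin n → Fin n → ℂ)
    {f : MvPolynomial (Fin n) ℂ} (hf : f ∈ SmallCircuits ℂ n b) :
    aeval (fun j => (X j + ∑ i ∈ Finset.univ.filter (fun i : Fin n => i < j), C (s i j) * X i :
      MvPolynomial (Fin n) ℂ)) f ∈ SmallCircuits ℂ n (b + 2) := by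
  obtain ⟨hdeg, hL⟩ := hf
  refine ⟨(totalDegree_aeval_affine_le _ (unipotent_affine s) f).trans hdeg, ?_⟩
  refine (complexity_aeval_affine_le _ f).trans ?_
  calc complexity f + ∑ j, complexity (X j + ∑ i ∈ Finset.univ.filter (fun i : Fin n => i < j),
          C (s i j) * X i : MvPolynomial (Fin n) ℂ)
      ≤ n ^ b + ∑ _j : Fin n, (2 * n + 1) :=
        Nat.add_le_add hL (Finset.sum_le_sum fun j _ => complexity_unipotent_row_le s j)
    _ = n ^ b + n * (2 * n + 1) := by
        rw [Finset.sum_const, Finset.card_univ, Fintype.card_fin, smul_eq_mul]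
    _ ≤ n ^ (b + 2) := by
        have hnb : n ≤ n ^ b := Nat.le_self_pow (by omega) n
        have key : n * (2 * n + 1) + n ≤ n * (n * n) := by nlinarith [Nat.mul_le_mul_right n hn]
        have hsq : 1 ≤ n * n := by nlinarith
        have key2 : n * (n * n) + n ^ b ≤ n ^ b * (n * n) + n := by nlinarith [hnb, hsq]
        rw [pow_add, pow_two]
        omega

/-- **The unipotent radical keeps every dc-slice on the nose.** [cite: MignonRessayre2004, §1] -/
theorem unipotent_mem_dcSlice {M : ℕ} (s : Fin n → Fin n → ℂ) {f : MvPolynomial (Fin n) ℂ}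
    (hf : f ∈ {f : MvPolynomial (Fin n) ℂ | f.totalDegree ≤ n ∧ determinantalComplexity f ≤ M}) :
    aeval (fun j => (X j + ∑ i ∈ Finset.univ.filter (fun i : Fin n => i < j), C (s i j) * X i :
      MvPolynomial (Fin n) ℂ)) f ∈
      {f : MvPolynomial (Fin n) ℂ | f.totalDegree ≤ n ∧ determinantalComplexity f ≤ M} :=
  ⟨(totalDegree_aeval_affine_le _ (unipotent_affine s) f).trans hf.1,
    (determinantalComplexity_aeval_affine_le f _ (unipotent_affine s)).trans hf.2⟩

/-- **Equations two rungs up vanish on all unipotent translates**: if `E` vanishes at `coeff f` for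
every `f ∈ SmallCircuits ℂ n (b+2)` (`b ≥ 1`, `n ≥ 3`), then `E(coeff(f ∘ u_s)) = 0` for every
`f ∈ SmallCircuits ℂ n b` and every upper unitriangular `u_s`. [folklore] -/
theorem eval_eq_zero_of_unipotent (hn : 3 ≤ n) {b : ℕ} (hb : 1 ≤ b)
    {E : MvPolynomial (degLEMonomials n) ℂ}
    (hE : ∀ f ∈ SmallCircuits ℂ n (b + 2), eval (coeffVector (degLEMonomials n) f) E = 0)
    (s : Fin n → Fin n → ℂ) {f : MvPolynomial (Fin n) ℂ} (hf : f ∈ SmallCircuits ℂ n b) :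
    eval (coeffVector (degLEMonomials n)
      (aeval (fun j => (X j + ∑ i ∈ Finset.univ.filter (fun i : Fin n => i < j), C (s i j) * X i :
        MvPolynomial (Fin n) ℂ)) f)) E = 0 :=
  hE _ (unipotent_mem_smallCircuits hn hb s hf)

end Summit.ValiantsHypothesis.ValiantsHypothesis.Theorems.BarrierLever.IsobaricEquations

end
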